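import Summits.MatrixMultiplication.OmegaCensus.RingMetaCyclic
import Summits.MatrixMultiplication.OmegaCensus.PhaseArcCount

/-!
# ω-census, family (b3): conjecture C9 — 2-D PHASE BLOCKS for the Eisenstein groups `𝔽_p[ω] ⋊ C₃` (independence and count)

HONEST FRAMING (pub-omega census; verbatim): lottery ticket; floor = certified bounds/negative ranges.
Census BOOKKEEPING (conjecture C9 of the cell; pub-omega stpp-1 gen 21).  The Schmidt atoms `A(p,3) = 𝔽_{p²} ⋊ C₃`
(`p ≡ 2 (mod 3)`) are `EisCyc p = RCyc (Eis p) 3 ω` (`RingMetaCyclic.lean`); by `RCyc.RBox.not_boxUseful_of_pattern` a box is a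
forbidden-difference graph on `9 × 𝔽_p[ω]`, `𝔽_p[ω] ∋ V = x + yω ↔ (x, y) ∈ (ℤ/p)²`.  This file is the 2-D version of
`PhaseArcPatterns` / `PhaseArcCount`: cells are unions of trimmed PHASE BLOCKS `(⌊8x/p⌋, ⌊8y/p⌋) = φ ∈ P(c) ⊆ ℤ²`
(`blockCells`); a conflict `V − V' = dd(c,c')` needs BOTH coordinate congruences, and each coordinate obeys the 1-D arithmetic of
`PhaseArcs.no_conflict` (`coord_noConflict`), so the finite condition is `PairOK(re-data) ∨ PairOK(im-data)` per pair of columns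
and phases (`patIndep_blockCells`; data = phases/errors `8·val = a p + e` of the real and imaginary parts of the products
`ω^s α_i`, `ω^s β_j`, combined by the signed four-term sums `PhiR`).  COUNT: the explicit product arc set `blockArcSet ⊆ blockCells`
has exactly `Σ_c Σ_{φ ∈ P c} len₁·len₂` elements (`card_blockArcSet`) with `8·len ≥ p − lo − hi − 7` (`eight_mul_bLen_ge`).
For the Eisenstein family the errors are O(1) (take `α = 1/8`), so this gives box ratio `→ #P/64` (`≥ 140/64 > 9/5` available).
Nothing here is progress on `ω`.
-/

namespace Summit.MatrixMultiplication.OmegaCensus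

open Finset

namespace RCyc.RBox

/-- A column never forbids a difference to itself: `dd c c = 0`. [folklore] -/
theorem dd_self {R : Type*} [CommRing R] {q : ℕ} (u : R) (D : RCyc.RBox R q) (c : Fin 3 × Fin 3) : D.dd u c c = 0 := by
  simp only [dd]; ring

/-- `dd` as a signed sum of four products `u^s·α_i`, `u^s·β_j`. [folklore] -/
theorem dd_eq_four {R : Type*} [CommRing R] {q : ℕ} (u : R) (D : RCyc.RBox R q) (c c' : Fin 3 × Fin 3) :
    D.dd u c c' = act u (D.a c.1 + D.b c'.2) * D.α c'.1 - act u (D.a c.1 + D.b c'.2) * D.β c.2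
      + act u (D.a c.1 + D.b c.2) * D.β c'.2 - act u (D.a c'.1 + D.b c'.2) * D.α c.1 := by
  simp only [dd]; ring

/-- Pattern independence is hereditary. [folklore] -/
theorem PatIndep.anti {R : Type*} [CommRing R] {q : ℕ} {u : R} {D : RCyc.RBox R q} {T T' : Finset ((Fin 3 × Fin 3) × R)}
    (h : T' ⊆ T) (hT : D.PatIndep u T) : D.PatIndep u T' :=
  fun x hx y hy hxy => hT x (h hx) y (h hy) hxy

end RCyc.RBox

namespace EisArcs

variable {p : ℕ}

/-- The signed four-term sum of `PhaseArcPatterns` (phase shift / error of a column pair) for an `RBox`. [folklore] -/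
def PhiR {R : Type*} {q : ℕ} (D : RCyc.RBox R q) (aα aβ : ZMod q → Fin 3 → ℤ) (c c' : Fin 3 × Fin 3) : ℤ :=
  aα (D.a c.1 + D.b c'.2) c'.1 - aβ (D.a c.1 + D.b c'.2) c.2 + aβ (D.a c.1 + D.b c.2) c'.2 - aα (D.a c'.1 + D.b c'.2) c.1

/-- **One coordinate.** If `A − A' = v₁ − v₂ + v₃ − v₄` in `ZMod p` with `8·v_k.val = a_k p + e_k`, and `A`, `A'` lie in
trimmed phase blocks `φ`, `φ'` whose pair condition `PairOK` holds for `Φ = a₁ − a₂ + a₃ − a₄`, `E = e₁ − e₂ + e₃ − e₄`, this is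
absurd (`PhaseArcs.no_conflict`). [folklore] -/
theorem coord_noConflict [NeZero p] {A A' v₁ v₂ v₃ v₄ : ZMod p} (heq : A - A' = v₁ - v₂ + v₃ - v₄)
    {a₁ a₂ a₃ a₄ e₁ e₂ e₃ e₄ : ℤ} (h₁ : 8 * (v₁.val : ℤ) = a₁ * p + e₁) (h₂ : 8 * (v₂.val : ℤ) = a₂ * p + e₂)
    (h₃ : 8 * (v₃.val : ℤ) = a₃ * p + e₃) (h₄ : 8 * (v₄.val : ℤ) = a₄ * p + e₄)
    {φ φ' lo hi lo' hi' : ℤ} (hlo : 0 ≤ lo) (hhi : 0 ≤ hi) (hlo' : 0 ≤ lo') (hhi' : 0 ≤ hi')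
    (hA : φ * p + lo ≤ 8 * (A.val : ℤ)) (hA2 : 8 * (A.val : ℤ) + hi < (φ + 1) * p)
    (hA' : φ' * p + lo' ≤ 8 * (A'.val : ℤ)) (hA'2 : 8 * (A'.val : ℤ) + hi' < (φ' + 1) * p)
    (hok : PhaseArcs.PairOK p (a₁ - a₂ + a₃ - a₄) (e₁ - e₂ + e₃ - e₄) φ φ' lo hi lo' hi') : False := by
  have hp : (0 : ℤ) < p := by have := NeZero.pos p; exact_mod_cast this
  obtain ⟨hE, h0, hplus, hminus⟩ := hok
  have hcast : (((A.val : ℤ) - A'.val - (v₁.val - v₂.val + v₃.val - v₄.val) : ℤ) : ZMod p) = 0 := by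
    push_cast
    simp only [ZMod.natCast_val, ZMod.cast_id', id_eq]
    linear_combination heq
  obtain ⟨j, hj⟩ := (ZMod.intCast_zmod_eq_zero_iff_dvd _ p).1 hcast
  have key : 8 * ((A.val : ℤ) - A'.val) = (a₁ - a₂ + a₃ - a₄ + 8 * j) * p + (e₁ - e₂ + e₃ - e₄) := by
    linear_combination 8 * hj + h₁ - h₂ + h₃ - h₄
  exact PhaseArcs.no_conflict (δ := (A.val : ℤ) - A'.val - j * p) (j := j) hp hA hA2 hA' hA'2 hlo hhi hlo' hhi' hE
    (by linear_combination key) (by ring) h0 hplus hminus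

/-- The 2-D phase-block cell set: `(c, V)` with `re V` in the trimmed block `φ.1` and `im V` in the trimmed block `φ.2` for some
`φ ∈ P c`. [folklore] -/
def blockCells (p : ℕ) [NeZero p] (P : Fin 3 × Fin 3 → Finset (ℤ × ℤ))
    (lo₁ hi₁ lo₂ hi₂ : Fin 3 × Fin 3 → ℤ × ℤ → ℤ) : Finset ((Fin 3 × Fin 3) × Eis p) :=
  univ.filter fun x => ∃ φ ∈ P x.1,
    (φ.1 * p + lo₁ x.1 φ ≤ 8 * (x.2.re.val : ℤ) ∧ 8 * (x.2.re.val : ℤ) + hi₁ x.1 φ < (φ.1 + 1) * p) ∧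
    (φ.2 * p + lo₂ x.1 φ ≤ 8 * (x.2.im.val : ℤ) ∧ 8 * (x.2.im.val : ℤ) + hi₂ x.1 φ < (φ.2 + 1) * p)

/-- Membership in the block cell set. [folklore] -/
theorem mem_blockCells [NeZero p] {P : Fin 3 × Fin 3 → Finset (ℤ × ℤ)} {lo₁ hi₁ lo₂ hi₂ : Fin 3 × Fin 3 → ℤ × ℤ → ℤ}
    {x : (Fin 3 × Fin 3) × Eis p} : x ∈ blockCells p P lo₁ hi₁ lo₂ hi₂ ↔ ∃ φ ∈ P x.1,
    (φ.1 * p + lo₁ x.1 φ ≤ 8 * (x.2.re.val : ℤ) ∧ 8 * (x.2.re.val : ℤ) + hi₁ x.1 φ < (φ.1 + 1) * p) ∧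
    (φ.2 * p + lo₂ x.1 φ ≤ 8 * (x.2.im.val : ℤ) ∧ 8 * (x.2.im.val : ℤ) + hi₂ x.1 φ < (φ.2 + 1) * p) := by
  simp only [blockCells, mem_filter, mem_univ, true_and]

/-- **2-D phase blocks are independent** under `PairOK(re) ∨ PairOK(im)` for every pair of columns and phases. [folklore] -/
theorem patIndep_blockCells [NeZero p] (D : RCyc.RBox (Eis p) 3)
    (aR eR bR fR aI eI bI fI : ZMod 3 → Fin 3 → ℤ)
    (hαR : ∀ s i, 8 * ((RCyc.act Eis.w s * D.α i).re.val : ℤ) = aR s i * p + eR s i)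
    (hβR : ∀ s j, 8 * ((RCyc.act Eis.w s * D.β j).re.val : ℤ) = bR s j * p + fR s j)
    (hαI : ∀ s i, 8 * ((RCyc.act Eis.w s * D.α i).im.val : ℤ) = aI s i * p + eI s i)
    (hβI : ∀ s j, 8 * ((RCyc.act Eis.w s * D.β j).im.val : ℤ) = bI s j * p + fI s j)
    (P : Fin 3 × Fin 3 → Finset (ℤ × ℤ)) (lo₁ hi₁ lo₂ hi₂ : Fin 3 × Fin 3 → ℤ × ℤ → ℤ)
    (hlo₁ : ∀ c, ∀ φ ∈ P c, 0 ≤ lo₁ c φ) (hhi₁ : ∀ c, ∀ φ ∈ P c, 0 ≤ hi₁ c φ)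
    (hlo₂ : ∀ c, ∀ φ ∈ P c, 0 ≤ lo₂ c φ) (hhi₂ : ∀ c, ∀ φ ∈ P c, 0 ≤ hi₂ c φ)
    (hcond : ∀ c c', c ≠ c' → ∀ φ ∈ P c, ∀ φ' ∈ P c',
      PhaseArcs.PairOK p (PhiR D aR bR c c') (PhiR D eR fR c c') φ.1 φ'.1 (lo₁ c φ) (hi₁ c φ) (lo₁ c' φ') (hi₁ c' φ') ∨
      PhaseArcs.PairOK p (PhiR D aI bI c c') (PhiR D eI fI c c') φ.2 φ'.2 (lo₂ c φ) (hi₂ c φ) (lo₂ c' φ') (hi₂ c' φ')) :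
    D.PatIndep Eis.w (blockCells p P lo₁ hi₁ lo₂ hi₂) := by
  intro x hx y hy hxy heq
  obtain ⟨φ, hφ, ⟨hx1, hx2⟩, ⟨hx3, hx4⟩⟩ := mem_blockCells.1 hx
  obtain ⟨φ', hφ', ⟨hy1, hy2⟩, ⟨hy3, hy4⟩⟩ := mem_blockCells.1 hy
  by_cases hc : x.1 = y.1
  · rw [hc, RCyc.RBox.dd_self, sub_eq_zero] at heq
    exact hxy (Prod.ext hc heq)
  rw [RCyc.RBox.dd_eq_four] at heq
  set s₁ : ZMod 3 := D.a x.1.1 + D.b y.1.2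
  set s₂ : ZMod 3 := D.a x.1.1 + D.b x.1.2
  set s₃ : ZMod 3 := D.a y.1.1 + D.b y.1.2
  rcases hcond x.1 y.1 hc φ hφ φ' hφ' with hok | hok
  · have hre := congrArg QuadraticAlgebra.re heq
    simp only [QuadraticAlgebra.re_sub, QuadraticAlgebra.re_add] at hre
    exact coord_noConflict hre (hαR s₁ y.1.1) (hβR s₁ x.1.2) (hβR s₂ y.1.2) (hαR s₃ x.1.1)
      (hlo₁ _ _ hφ) (hhi₁ _ _ hφ) (hlo₁ _ _ hφ') (hhi₁ _ _ hφ') hx1 hx2 hy1 hy2 hok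
  · have him := congrArg QuadraticAlgebra.im heq
    simp only [QuadraticAlgebra.im_sub, QuadraticAlgebra.im_add] at him
    exact coord_noConflict him (hαI s₁ y.1.1) (hβI s₁ x.1.2) (hβI s₂ y.1.2) (hαI s₃ x.1.1)
      (hlo₂ _ _ hφ) (hhi₂ _ _ hφ) (hlo₂ _ _ hφ') (hhi₂ _ _ hφ') hx3 hx4 hy3 hy4 hok

/-! ### The explicit product arc set and its count -/

/-- First coordinate index of the arc of phase `φ₁` with bottom trim `l`: `⌈(φ₁ p + l)/8⌉`. [folklore] -/
def bStart (p : ℕ) (φ₁ l : ℤ) : ℤ := (φ₁ * p + l + 7) / 8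

/-- Last coordinate index of the arc of phase `φ₁` with top trim `h`: `⌊((φ₁+1) p − h − 1)/8⌋`. [folklore] -/
def bStop (p : ℕ) (φ₁ h : ℤ) : ℤ := ((φ₁ + 1) * p - h - 1) / 8

/-- The arc length (as an integer; nonpositive when the arc is empty). [folklore] -/
def bLen (p : ℕ) (φ₁ l h : ℤ) : ℤ := bStop p φ₁ h + 1 - bStart p φ₁ l

/-- Each arc is long: `8·len ≥ p − l − h − 7`. [folklore] -/
theorem eight_mul_bLen_ge (φ₁ l h : ℤ) : (p : ℤ) - l - h - 7 ≤ 8 * bLen p φ₁ l h := by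
  simp only [bLen, bStart, bStop]
  have : (φ₁ + 1) * (p : ℤ) = φ₁ * p + p := by ring
  omega

/-- Bounds of an arc index: `0 ≤ n < p` and the trimmed block inequalities for `8n`. [folklore] -/
theorem b_bounds {φ₁ l h n : ℤ} (hφ : 0 ≤ φ₁ ∧ φ₁ < 8) (hl : 0 ≤ l) (hh : 0 ≤ h)
    (hn : n ∈ Icc (bStart p φ₁ l) (bStop p φ₁ h)) :
    0 ≤ n ∧ n < p ∧ φ₁ * p + l ≤ 8 * n ∧ 8 * n + h < (φ₁ + 1) * p := by
  rw [mem_Icc, bStart, bStop] at hn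
  obtain ⟨h1, h2⟩ := hn
  have hp0 : (0 : ℤ) ≤ p := by positivity
  refine ⟨?_, ?_, by omega, by omega⟩
  · have : 0 ≤ φ₁ * (p : ℤ) := mul_nonneg hφ.1 hp0
    omega
  · have : (φ₁ + 1) * (p : ℤ) ≤ 8 * p := by nlinarith
    omega

/-- The explicit arc set: column `c`, phase `φ ∈ P c`, elements `⟨n₁, n₂⟩ = n₁ + n₂ ω` over the product of the two arcs. [folklore] -/
noncomputable def blockArcSet (p : ℕ) [NeZero p] (P : Fin 3 × Fin 3 → Finset (ℤ × ℤ))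
    (lo₁ hi₁ lo₂ hi₂ : Fin 3 × Fin 3 → ℤ × ℤ → ℤ) : Finset ((Fin 3 × Fin 3) × Eis p) :=
  (univ : Finset (Fin 3 × Fin 3)).biUnion fun c => (P c).biUnion fun φ =>
    (Icc (bStart p φ.1 (lo₁ c φ)) (bStop p φ.1 (hi₁ c φ)) ×ˢ Icc (bStart p φ.2 (lo₂ c φ)) (bStop p φ.2 (hi₂ c φ))).image
      fun n : ℤ × ℤ => (c, (⟨(n.1 : ZMod p), (n.2 : ZMod p)⟩ : Eis p))

section

variable [NeZero p] {P : Fin 3 × Fin 3 → Finset (ℤ × ℤ)} {lo₁ hi₁ lo₂ hi₂ : Fin 3 × Fin 3 → ℤ × ℤ → ℤ}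
  (hP : ∀ c, ∀ φ ∈ P c, (0 ≤ φ.1 ∧ φ.1 < 8) ∧ (0 ≤ φ.2 ∧ φ.2 < 8))
  (hlo₁ : ∀ c, ∀ φ ∈ P c, 0 ≤ lo₁ c φ) (hhi₁ : ∀ c, ∀ φ ∈ P c, 0 ≤ hi₁ c φ)
  (hlo₂ : ∀ c, ∀ φ ∈ P c, 0 ≤ lo₂ c φ) (hhi₂ : ∀ c, ∀ φ ∈ P c, 0 ≤ hi₂ c φ)
include hP hlo₁ hhi₁ hlo₂ hhi₂

/-- **The arc set lies in the block cell set.** [folklore] -/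
theorem blockArcSet_subset : blockArcSet p P lo₁ hi₁ lo₂ hi₂ ⊆ blockCells p P lo₁ hi₁ lo₂ hi₂ := by
  intro x hx
  simp only [blockArcSet, mem_biUnion, mem_univ, true_and, mem_image, mem_product] at hx
  obtain ⟨c, φ, hφ, n, ⟨hn1, hn2⟩, rfl⟩ := hx
  obtain ⟨h0, hp', h1, h2⟩ := b_bounds (hP c φ hφ).1 (hlo₁ c φ hφ) (hhi₁ c φ hφ) hn1
  obtain ⟨h0', hp'', h1', h2'⟩ := b_bounds (hP c φ hφ).2 (hlo₂ c φ hφ) (hhi₂ c φ hφ) hn2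
  rw [mem_blockCells]
  refine ⟨φ, hφ, ?_, ?_⟩
  · simp only [PhaseArcs.val_cast_of_bounds h0 hp']
    exact ⟨h1, h2⟩
  · simp only [PhaseArcs.val_cast_of_bounds h0' hp'']
    exact ⟨h1', h2'⟩

/-- The element map `n ↦ (c, n₁ + n₂ ω)` is injective on a product of arcs. [folklore] -/
theorem injOn_arcs (c : Fin 3 × Fin 3) {φ : ℤ × ℤ} (hφ : φ ∈ P c) :
    Set.InjOn (fun n : ℤ × ℤ => (c, (⟨(n.1 : ZMod p), (n.2 : ZMod p)⟩ : Eis p)))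
      ((Icc (bStart p φ.1 (lo₁ c φ)) (bStop p φ.1 (hi₁ c φ)) ×ˢ
        Icc (bStart p φ.2 (lo₂ c φ)) (bStop p φ.2 (hi₂ c φ)) : Finset (ℤ × ℤ)) : Set (ℤ × ℤ)) := by
  intro n hn n' hn' e
  rw [mem_coe, mem_product] at hn hn'
  simp only [Prod.mk.injEq, true_and, QuadraticAlgebra.mk.injEq] at e
  have hb1 := b_bounds (hP c φ hφ).1 (hlo₁ c φ hφ) (hhi₁ c φ hφ) hn.1
  have hb2 := b_bounds (hP c φ hφ).2 (hlo₂ c φ hφ) (hhi₂ c φ hφ) hn.2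
  have hb1' := b_bounds (hP c φ hφ).1 (hlo₁ c φ hφ) (hhi₁ c φ hφ) hn'.1
  have hb2' := b_bounds (hP c φ hφ).2 (hlo₂ c φ hφ) (hhi₂ c φ hφ) hn'.2
  have e1 := congrArg (fun z : ZMod p => (z.val : ℤ)) e.1
  have e2 := congrArg (fun z : ZMod p => (z.val : ℤ)) e.2
  simp only [PhaseArcs.val_cast_of_bounds hb1.1 hb1.2.1, PhaseArcs.val_cast_of_bounds hb1'.1 hb1'.2.1,
    PhaseArcs.val_cast_of_bounds hb2.1 hb2.2.1, PhaseArcs.val_cast_of_bounds hb2'.1 hb2'.2.1] at e1 e2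
  exact Prod.ext e1 e2

/-- **Exact count of the arc set**: `Σ_c Σ_{φ ∈ P c} len₁ · len₂`. [folklore] -/
theorem card_blockArcSet : #(blockArcSet p P lo₁ hi₁ lo₂ hi₂) =
    ∑ c, ∑ φ ∈ P c, (bLen p φ.1 (lo₁ c φ) (hi₁ c φ)).toNat * (bLen p φ.2 (lo₂ c φ) (hi₂ c φ)).toNat := by
  rw [blockArcSet, card_biUnion]
  · refine sum_congr rfl fun c _ => ?_
    rw [card_biUnion]
    · refine sum_congr rfl fun φ hφ => ?_
      rw [card_image_of_injOn (injOn_arcs hP hlo₁ hhi₁ hlo₂ hhi₂ c hφ), card_product, Int.card_Icc, Int.card_Icc]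
      rfl
    · -- blocks of distinct phases in one column are disjoint
      intro φ hφ φ' hφ' hne
      rw [Function.onFun, disjoint_left]
      intro x hx hx'
      rw [mem_image] at hx hx'
      obtain ⟨n, hn, rfl⟩ := hx
      obtain ⟨n', hn', e⟩ := hx'
      rw [mem_product] at hn hn'
      simp only [Prod.mk.injEq, true_and, QuadraticAlgebra.mk.injEq] at e
      have hb1 := b_bounds (hP c φ hφ).1 (hlo₁ c φ hφ) (hhi₁ c φ hφ) hn.1
      have hb2 := b_bounds (hP c φ hφ).2 (hlo₂ c φ hφ) (hhi₂ c φ hφ) hn.2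
      have hb1' := b_bounds (hP c φ' hφ').1 (hlo₁ c φ' hφ') (hhi₁ c φ' hφ') hn'.1
      have hb2' := b_bounds (hP c φ' hφ').2 (hlo₂ c φ' hφ') (hhi₂ c φ' hφ') hn'.2
      have e1 := congrArg (fun z : ZMod p => (z.val : ℤ)) e.1
      have e2 := congrArg (fun z : ZMod p => (z.val : ℤ)) e.2
      simp only [PhaseArcs.val_cast_of_bounds hb1.1 hb1.2.1, PhaseArcs.val_cast_of_bounds hb1'.1 hb1'.2.1,
        PhaseArcs.val_cast_of_bounds hb2.1 hb2.2.1, PhaseArcs.val_cast_of_bounds hb2'.1 hb2'.2.1] at e1 e2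
      -- n' = n coordinatewise; the trims are ≥ 0, so both phases are determined
      have hl1 := hlo₁ c φ hφ; have hh1 := hhi₁ c φ hφ; have hl1' := hlo₁ c φ' hφ'; have hh1' := hhi₁ c φ' hφ'
      have hl2 := hlo₂ c φ hφ; have hh2 := hhi₂ c φ hφ; have hl2' := hlo₂ c φ' hφ'; have hh2' := hhi₂ c φ' hφ'
      have hp0 : (0 : ℤ) < p := by have := NeZero.pos p; exact_mod_cast this
      apply hne
      refine Prod.ext ?_ ?_
      · by_contra hne1
        rcases lt_or_gt_of_ne hne1 with hlt | hlt
        · have : (φ.1 + 1) * (p : ℤ) ≤ φ'.1 * p := by nlinarith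
          omega
        · have : (φ'.1 + 1) * (p : ℤ) ≤ φ.1 * p := by nlinarith
          omega
      · by_contra hne2
        rcases lt_or_gt_of_ne hne2 with hlt | hlt
        · have : (φ.2 + 1) * (p : ℤ) ≤ φ'.2 * p := by nlinarith
          omega
        · have : (φ'.2 + 1) * (p : ℤ) ≤ φ.2 * p := by nlinarith
          omega
  · -- different columns give disjoint sets
    intro c _ c' _ hne
    rw [Function.onFun, disjoint_left]
    intro x hx hx'
    simp only [mem_biUnion, mem_image] at hx hx'
    obtain ⟨φ, -, n, -, rfl⟩ := hx
    obtain ⟨φ', -, n', -, e⟩ := hx'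
    simp only [Prod.mk.injEq] at e
    exact hne e.1.symm

end

end EisArcs

end Summit.MatrixMultiplication.OmegaCensus
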